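import Summits.AtomisticToContinuum.HydrodynamicLimit.Theorems.CollisionIsometryCLTMacroClosureThermoLimitA
import Summits.AtomisticToContinuum.HydrodynamicLimit.Theorems.CollisionIsometryCLTMacroClosureTlDini
import Summits.AtomisticToContinuum.HydrodynamicLimit.Theorems.CollisionIsometryCLTMacroClosureRuelleConvexity
import Summits.AtomisticToContinuum.HydrodynamicLimit.Theorems.CollisionIsometryCLTMacroClosureStubClausiusLimits
import HarnessLib

/-!
# The thermodynamic limit of the hard-sphere free volume, part B: existence and identification

Support file (`--supports stmt-AtomisticToContinuum-14870`) of the lead of the line `IdeatorTwoGen1Sketch`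
for the crux `MacroClosure`; second half of the thermodynamic-limit step of the stub `stub_blockMGF`.

With `B(m, η)` Ruelle's inner-cube box free volume and `b(m, η) = −m⁻¹ log B(m, η)` (part A,
`…ThermoLimitA.lean`), the torus rate `a_N(η) = −N⁻¹ log hsFreeVolume η N` is squeezed:

* `a_N(η) ≤ b(N, η)` (the box set is a subset of the torus non-overlap set; `tl_chart`);
* `a_N(η) ≥ b(N, η̂_N) + 3 log(1 − t̂_N)` with `η̂_N ↑ η`, `t̂_N → 0` (torus free volume ≤ unit-cube
  Euclidean free volume, `FvCubeToTorus.volume_posDomain_le`, and scaling).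

Together with the chain inequality `limsup b(·, η') ≤ liminf b(·, η)` (`thermo_box_chain`) and the
CONTINUITY of `f_ex = hsExcessFreeEnergy` on `(0, 11/10)` (Ruelle convexity, landed: `stub_hsFreeEnergyConvex`
and `Clausius.continuousOn_hsExcessFreeEnergy`) this gives the registered helper `hs_thermoLimit`:

`∀ η ∈ (0, 11/10), −N⁻¹ log hsFreeVolume η N → hsExcessFreeEnergy η` (the limit EXISTS),

and the box version with the uniform lower bound the block large deviations need (`hs_boxRate_uniform`):
on every compact `[a, c] ⊂ (0, 11/10)` and for every `ε > 0`, eventually in `m`,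
`B(m, η) ≤ exp(−m (f_ex(η) − ε))` for all `η ∈ [a, c]` (`tl_dini`).

Reference: D. Ruelle, *Statistical Mechanics: Rigorous Results* (1969), §3.4, Thm 3.4.4.
-/

noncomputable section

open MeasureTheory Filter Set Topology
open scoped ENNReal Pointwise

namespace Summit.AtomisticToContinuum.HydrodynamicLimit.Theorems.MacroClosureLine

open Literature.MathematicalPhysics.KineticTheory Literature.Analysis.FluidPDE
open Literature.Analysis.FunctionSpaces
open Summit.AtomisticToContinuum.HydrodynamicLimit.Theses

namespace Barycentric

namespace ThermoLimit

section BoxFunction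

variable {B : ℕ → ℝ → ℝ}
  (hB : ∀ (m : ℕ) (η : ℝ), B m η = (volume {w : Fin m → V3 |
    (∀ i l, |w i l| ≤ (1 - (η / m) ^ (1 / 3 : ℝ)) / 2) ∧
      ∀ i j, i ≠ j → (η / m) ^ (1 / 3 : ℝ) ≤ ‖w i - w j‖}).toReal)

include hB

/-! ### Squeeze (i): the box set lies in the torus non-overlap set -/

/-- `B(m, η) ≤ hsFreeVolume η m` for `m ≥ 2`, `0 < η ≤ 23/20` (`tl_chart` at centre `0`, then drop the
cube condition). -/
theorem box_le_hsFreeVolume {m : ℕ} (hm : 2 ≤ m) {η : ℝ} (hη : 0 < η) (hη' : η ≤ 23 / 20) :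
    B m η ≤ hsFreeVolume η m := by
  obtain ⟨ht0, ht1⟩ := ThermoLimitA.t_props hm hη hη'
  set t : ℝ := (η / m) ^ (1 / 3 : ℝ) with ht
  have hchart := tl_chart m (0 : T3) (1 - t) t (by linarith) ht0 (by linarith)
  rw [hB, EosCesaro.hsFreeVolume_eq_toReal, ← ht, ← hchart]
  refine ENNReal.toReal_mono (measure_ne_top _ _) (measure_mono ?_)
  intro q hq i j hij
  exact hq.2 i j hij

/-- Hence `a_m(η) ≤ b(m, η)` wherever `B(m, η) > 0`. -/
theorem rate_le_boxRate {m : ℕ} (hm : 2 ≤ m) {η : ℝ} (hη : 0 < η) (hη' : η ≤ 23 / 20)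
    (hpos : 0 < B m η) :
    -(m : ℝ)⁻¹ * Real.log (hsFreeVolume η m) ≤ -(m : ℝ)⁻¹ * Real.log (B m η) := by
  have hlog := Real.log_le_log hpos (box_le_hsFreeVolume hB hm hη hη')
  have : -(m : ℝ)⁻¹ ≤ 0 := by simp
  exact mul_le_mul_of_nonpos_left hlog this

/-! ### Squeeze (ii): the torus non-overlap set read in the unit cube, rescaled -/

/-- With `e = (η/N)^{1/3}`, `t̂ = e/(1+e)`, `η̂ = N t̂³`:
`(1 − t̂)^{3N} · hsFreeVolume η N ≤ B(N, η̂)`. -/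
theorem scaled_hsFreeVolume_le_box {N : ℕ} (hN : 2 ≤ N) {η : ℝ} (hη : 0 < η) (hη' : η ≤ 23 / 20) :
    (1 - (η / N) ^ (1 / 3 : ℝ) / (1 + (η / N) ^ (1 / 3 : ℝ))) ^ (3 * N) * hsFreeVolume η N ≤
      B N (N * ((η / N) ^ (1 / 3 : ℝ) / (1 + (η / N) ^ (1 / 3 : ℝ))) ^ 3) := by
  obtain ⟨he0, he1⟩ := ThermoLimitA.t_props hN hη hη'
  set e : ℝ := (η / N) ^ (1 / 3 : ℝ) with he
  have hN0 : (0 : ℝ) < N := by exact_mod_cast (lt_of_lt_of_le (by norm_num) hN)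
  set s : ℝ := 1 - e / (1 + e) with hs
  have hs_eq : s = 1 / (1 + e) := by rw [hs]; field_simp; ring
  have hs0 : 0 < s := by rw [hs_eq]; positivity
  have hs1 : s ≤ 1 := by rw [hs_eq, div_le_one (by linarith)]; linarith
  -- the density η̂ has exclusion parameter t̂ = e/(1+e)
  have hthat : (N * (e / (1 + e)) ^ 3 / N) ^ (1 / 3 : ℝ) = e / (1 + e) := by
    have hc : (N : ℝ) * (e / (1 + e)) ^ 3 / N = (e / (1 + e)) ^ 3 := by field_simp
    rw [hc, ← Real.rpow_natCast, ← Real.rpow_mul (by positivity)]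
    norm_num
  -- torus ≤ unit cube, rescaled by s
  have h1 : volume (posDomain e N) ≤
      volume {w : Fin N → V3 | (∀ i l, |w i l| ≤ 1 / 2) ∧ ∀ i i', i ≠ i' → e ≤ ‖w i - w i'‖} :=
    FvCubeToTorus.volume_posDomain_le N e
  have h2 : s • {w : Fin N → V3 | (∀ i l, |w i l| ≤ 1 / 2) ∧ ∀ i i', i ≠ i' → (e / (1 + e)) / s ≤ ‖w i - w i'‖} ⊆
      {v : Fin N → V3 | (∀ i l, |v i l| ≤ s / 2) ∧ ∀ i i', i ≠ i' → e / (1 + e) ≤ ‖v i - v i'‖} :=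
    FvCubeToTorus.smul_set_subset N (e / (1 + e)) hs0
  have hes : (e / (1 + e)) / s = e := by rw [hs_eq]; field_simp
  rw [hes] at h2
  have h3 := FvCubeToTorus.volume_smul_set N hs0.le
    {w : Fin N → V3 | (∀ i l, |w i l| ≤ 1 / 2) ∧ ∀ i i', i ≠ i' → e ≤ ‖w i - w i'‖}
  -- assemble in ℝ≥0∞
  have key : ENNReal.ofReal (s ^ (3 * N)) * volume (posDomain e N) ≤
      volume {v : Fin N → V3 | (∀ i l, |v i l| ≤ s / 2) ∧ ∀ i i', i ≠ i' → e / (1 + e) ≤ ‖v i - v i'‖} := by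
    calc ENNReal.ofReal (s ^ (3 * N)) * volume (posDomain e N)
        ≤ ENNReal.ofReal (s ^ (3 * N)) *
          volume {w : Fin N → V3 | (∀ i l, |w i l| ≤ 1 / 2) ∧ ∀ i i', i ≠ i' → e ≤ ‖w i - w i'‖} := by
          gcongr
      _ = volume (s • {w : Fin N → V3 | (∀ i l, |w i l| ≤ 1 / 2) ∧ ∀ i i', i ≠ i' → e ≤ ‖w i - w i'‖}) :=
          h3.symm
      _ ≤ _ := measure_mono h2
  -- convert to reals
  have hfin : volume {v : Fin N → V3 | (∀ i l, |v i l| ≤ s / 2) ∧ ∀ i i', i ≠ i' → e / (1 + e) ≤ ‖v i - v i'‖}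
      ≠ ⊤ := ne_top_of_le_ne_top ENNReal.one_ne_top (tl_mono.2.2 N s (e / (1 + e)) hs0.le hs1)
  have := ENNReal.toReal_mono hfin key
  rw [ENNReal.toReal_mul, ENNReal.toReal_ofReal (by positivity), ← EosCesaro.hsFreeVolume_eq_toReal] at this
  rw [hB]
  simp only [hthat]
  simp only [hs] at this
  exact this

/-- Hence, where `hsFreeVolume η N > 0`:
`b(N, η̂_N) + 3 log(1 − t̂_N) ≤ a_N(η)`. -/
theorem boxRate_le_rate {N : ℕ} (hN : 2 ≤ N) {η : ℝ} (hη : 0 < η) (hη' : η ≤ 23 / 20)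
    (hpos : 0 < hsFreeVolume η N) :
    -(N : ℝ)⁻¹ * Real.log (B N (N * ((η / N) ^ (1 / 3 : ℝ) / (1 + (η / N) ^ (1 / 3 : ℝ))) ^ 3)) +
        3 * Real.log (1 - (η / N) ^ (1 / 3 : ℝ) / (1 + (η / N) ^ (1 / 3 : ℝ))) ≤
      -(N : ℝ)⁻¹ * Real.log (hsFreeVolume η N) := by
  obtain ⟨he0, he1⟩ := ThermoLimitA.t_props hN hη hη'
  have hN0 : (0 : ℝ) < N := by exact_mod_cast (lt_of_lt_of_le (by norm_num) hN)
  have hkey := scaled_hsFreeVolume_le_box hB hN hη hη'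
  set e : ℝ := (η / N) ^ (1 / 3 : ℝ) with he
  have hs0 : 0 < 1 - e / (1 + e) := by
    have : 1 - e / (1 + e) = 1 / (1 + e) := by field_simp; ring
    rw [this]; positivity
  have hlhs : 0 < (1 - e / (1 + e)) ^ (3 * N) * hsFreeVolume η N := by positivity
  have hlog := Real.log_le_log hlhs hkey
  rw [Real.log_mul (by positivity) hpos.ne', Real.log_pow] at hlog
  push_cast at hlog
  have hinv : 0 < (N : ℝ)⁻¹ := inv_pos.2 hN0
  have := mul_le_mul_of_nonneg_left hlog hinv.le
  have e3 : (N : ℝ)⁻¹ * (3 * N * Real.log (1 - e / (1 + e))) = 3 * Real.log (1 - e / (1 + e)) := by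
    field_simp
  nlinarith [this, e3]

end BoxFunction

/-! ### The limits -/

/-- `(η/N)^{1/3} → 0`. -/
theorem tendsto_e (η : ℝ) : Tendsto (fun N : ℕ => (η / N) ^ (1 / 3 : ℝ)) atTop (𝓝 0) := by
  have h1 : Tendsto (fun N : ℕ => η / (N : ℝ)) atTop (𝓝 0) := tendsto_const_div_atTop_nhds_zero_nat η
  have h2 := h1.rpow_const (p := (1 / 3 : ℝ)) (Or.inr (by norm_num))
  simpa [Real.zero_rpow (by norm_num : (1 / 3 : ℝ) ≠ 0)] using h2

/-- `η̂_N = N t̂_N³ = η/(1 + e_N)³ → η`. -/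
theorem tendsto_etaHat {η : ℝ} (hη : 0 ≤ η) :
    Tendsto (fun N : ℕ => (N : ℝ) * ((η / N) ^ (1 / 3 : ℝ) / (1 + (η / N) ^ (1 / 3 : ℝ))) ^ 3) atTop (𝓝 η) := by
  have hev : ∀ᶠ N : ℕ in atTop,
      (N : ℝ) * ((η / N) ^ (1 / 3 : ℝ) / (1 + (η / N) ^ (1 / 3 : ℝ))) ^ 3 =
        η / (1 + (η / N) ^ (1 / 3 : ℝ)) ^ 3 := by
    filter_upwards [Filter.eventually_gt_atTop 0] with N hN
    have hN0 : (0 : ℝ) < N := by exact_mod_cast hN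
    have he3 : ((η / N) ^ (1 / 3 : ℝ)) ^ 3 = η / N :=
      FvMixingParams.rpow_third_pow_three _ (div_nonneg hη hN0.le)
    rw [div_pow, he3]; field_simp
  refine (Filter.tendsto_congr' hev).2 ?_
  have h := ((tendsto_e η).const_add 1).pow 3
  have h' : Tendsto (fun N : ℕ => η / (1 + (η / N) ^ (1 / 3 : ℝ)) ^ 3) atTop (𝓝 (η / (1 + 0) ^ 3)) :=
    tendsto_const_nhds.div h (by norm_num)
  simpa using h'

/-- `3 log(1 − t̂_N) → 0`. -/
theorem tendsto_log_corr (η : ℝ) :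
    Tendsto (fun N : ℕ => 3 * Real.log (1 - (η / N) ^ (1 / 3 : ℝ) / (1 + (η / N) ^ (1 / 3 : ℝ))))
      atTop (𝓝 0) := by
  have h1 := tendsto_e η
  have h2 : Tendsto (fun N : ℕ => (η / N) ^ (1 / 3 : ℝ) / (1 + (η / N) ^ (1 / 3 : ℝ))) atTop (𝓝 0) := by
    have h := h1.div (h1.const_add 1) (by norm_num)
    rw [zero_div] at h
    exact h
  have h3 : Tendsto (fun N : ℕ => 1 - (η / N) ^ (1 / 3 : ℝ) / (1 + (η / N) ^ (1 / 3 : ℝ))) atTop (𝓝 1) := by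
    simpa using h2.const_sub 1
  have h4 := (Real.continuousAt_log one_ne_zero).tendsto.comp h3
  rw [Real.log_one] at h4
  simpa using h4.const_mul 3

/-! ### Existence of the thermodynamic limit -/

/-- **The torus thermodynamic limit exists**: for `0 < η < 11/10`,
`−N⁻¹ log hsFreeVolume η N → hsExcessFreeEnergy η`. [cite: Ruelle1969, Thm 3.4.4] -/
theorem tendsto_rate {η : ℝ} (hη : 0 < η) (hη1 : η < 11 / 10) :
    Tendsto (fun N : ℕ => -(N : ℝ)⁻¹ * Real.log (hsFreeVolume η N)) atTop (𝓝 (hsExcessFreeEnergy η)) := by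
  -- the box function and its structural properties
  set B : ℕ → ℝ → ℝ := fun m η => (volume {w : Fin m → V3 |
    (∀ i l, |w i l| ≤ (1 - (η / m) ^ (1 / 3 : ℝ)) / 2) ∧
      ∀ i j, i ≠ j → (η / m) ^ (1 / 3 : ℝ) ≤ ‖w i - w j‖}).toReal with hBdef
  have hB : ∀ (m : ℕ) (η : ℝ), B m η = (volume {w : Fin m → V3 |
      (∀ i l, |w i l| ≤ (1 - (η / m) ^ (1 / 3 : ℝ)) / 2) ∧
        ∀ i j, i ≠ j → (η / m) ^ (1 / 3 : ℝ) ≤ ‖w i - w j‖}).toReal := fun _ _ => rfl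
  obtain ⟨C, hC, M, hM, hP0, hP4⟩ := ThermoLimitA.rate_props hB
  have hη23 : η ≤ 23 / 20 := by linarith
  -- generic eventual bounds for the box rate on [0, 23/20]
  have hb_ev : ∀ η' : ℝ, 0 ≤ η' → η' ≤ 23 / 20 → ∀ᶠ m : ℕ in atTop,
      0 < B m η' ∧ 0 ≤ -(m : ℝ)⁻¹ * Real.log (B m η') ∧ -(m : ℝ)⁻¹ * Real.log (B m η') ≤ C :=
    fun η' h0 h1 => Filter.eventually_atTop.2 ⟨M, fun m hm => hP0 m hm η' h0 h1⟩
  have hb_bdd : ∀ η' : ℝ, 0 ≤ η' → η' ≤ 23 / 20 →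
      IsBoundedUnder (· ≤ ·) atTop (fun m : ℕ => -(m : ℝ)⁻¹ * Real.log (B m η')) ∧
      IsBoundedUnder (· ≥ ·) atTop (fun m : ℕ => -(m : ℝ)⁻¹ * Real.log (B m η')) :=
    fun η' h0 h1 => ⟨Filter.isBoundedUnder_of_eventually_le ((hb_ev η' h0 h1).mono fun m hm => hm.2.2),
      Filter.isBoundedUnder_of_eventually_ge ((hb_ev η' h0 h1).mono fun m hm => hm.2.1)⟩
  -- generic eventual bounds for the torus rate on (0, 23/20]
  have ha_ev : ∀ η' : ℝ, 0 < η' → η' ≤ 23 / 20 → ∀ᶠ m : ℕ in atTop,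
      0 < hsFreeVolume η' m ∧
      -(m : ℝ)⁻¹ * Real.log (hsFreeVolume η' m) ≤ -(m : ℝ)⁻¹ * Real.log (B m η') := by
    intro η' h0 h1
    filter_upwards [Filter.eventually_ge_atTop M] with m hm
    have hm2 : 2 ≤ m := hM.trans hm
    have hpos := (hP0 m hm η' h0.le h1).1
    exact ⟨hpos.trans_le (box_le_hsFreeVolume hB hm2 h0 h1), rate_le_boxRate hB hm2 h0 h1 hpos⟩
  have ha_bdd : ∀ η' : ℝ, 0 < η' → η' ≤ 23 / 20 →
      IsBoundedUnder (· ≤ ·) atTop (fun m : ℕ => -(m : ℝ)⁻¹ * Real.log (hsFreeVolume η' m)) ∧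
      IsBoundedUnder (· ≥ ·) atTop (fun m : ℕ => -(m : ℝ)⁻¹ * Real.log (hsFreeVolume η' m)) :=
    fun η' h0 h1 => ⟨Filter.isBoundedUnder_of_eventually_le
        (((ha_ev η' h0 h1).and (hb_ev η' h0.le h1)).mono fun m hm => hm.1.2.trans hm.2.2.2),
      Filter.isBoundedUnder_of ⟨0, fun m => HsFreeEnergyConvex.rate_nonneg η' m⟩⟩
  -- KEY: for 0 < δ < η, f(η − δ) ≤ liminf a(η)
  have hkey : ∀ δ : ℝ, 0 < δ → δ < η →
      hsExcessFreeEnergy (η - δ) ≤ liminf (fun N : ℕ => -(N : ℝ)⁻¹ * Real.log (hsFreeVolume η N)) atTop := by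
    intro δ hδ hδη
    have hηδ0 : 0 < η - δ := by linarith
    have hηδ1 : η - δ ≤ 23 / 20 := by linarith
    -- (1) f(η − δ) ≤ limsup b(·, η − δ)
    have h1 : hsExcessFreeEnergy (η - δ) ≤ limsup (fun m : ℕ => -(m : ℝ)⁻¹ * Real.log (B m (η - δ))) atTop := by
      unfold hsExcessFreeEnergy
      exact Filter.limsup_le_limsup ((ha_ev _ hηδ0 hηδ1).mono fun m hm => hm.2)
        (ha_bdd _ hηδ0 hηδ1).2.isCoboundedUnder_flip (hb_bdd _ hηδ0.le hηδ1).1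
    -- (2) the chain inequality
    have h2 : limsup (fun m : ℕ => -(m : ℝ)⁻¹ * Real.log (B m (η - δ))) atTop ≤
        liminf (fun m : ℕ => -(m : ℝ)⁻¹ * Real.log (B m (η - δ / 2))) atTop :=
      thermo_box_chain (η - δ / 2) (η - δ) hηδ0.le (by linarith) (by linarith)
    -- (3) liminf b(·, η − δ/2) ≤ liminf a(η)
    have hη'0 : 0 < η - δ / 2 := by linarith
    have hη'1 : η - δ / 2 ≤ 23 / 20 := by linarith
    have h3 : liminf (fun m : ℕ => -(m : ℝ)⁻¹ * Real.log (B m (η - δ / 2))) atTop ≤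
        liminf (fun N : ℕ => -(N : ℝ)⁻¹ * Real.log (hsFreeVolume η N)) atTop := by
      refine le_of_forall_lt_imp_le_of_dense fun c hc => ?_
      set L : ℝ := liminf (fun m : ℕ => -(m : ℝ)⁻¹ * Real.log (B m (η - δ / 2))) atTop with hL
      have hgap : 0 < (L - c) / 2 := by linarith
      -- eventually b m (η − δ/2) > (L + c)/2
      have e5 : ∀ᶠ m : ℕ in atTop, (L + c) / 2 < -(m : ℝ)⁻¹ * Real.log (B m (η - δ / 2)) :=
        Filter.eventually_lt_of_lt_liminf (by rw [← hL]; linarith) (hb_bdd _ hη'0.le hη'1).2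
      -- eventually η − δ/2 ≤ η̂_m ≤ 23/20
      have hhat := tendsto_etaHat (η := η) hη.le
      have e2 : ∀ᶠ m : ℕ in atTop, η - δ / 2 < (m : ℝ) * ((η / m) ^ (1 / 3 : ℝ) / (1 + (η / m) ^ (1 / 3 : ℝ))) ^ 3 :=
        hhat.eventually (Ioi_mem_nhds (by linarith))
      have e3 : ∀ᶠ m : ℕ in atTop, (m : ℝ) * ((η / m) ^ (1 / 3 : ℝ) / (1 + (η / m) ^ (1 / 3 : ℝ))) ^ 3 < 23 / 20 :=
        hhat.eventually (Iio_mem_nhds (by linarith))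
      -- eventually the logarithmic correction is ≥ −gap
      have e4 : ∀ᶠ m : ℕ in atTop,
          -((L - c) / 2) < 3 * Real.log (1 - (η / m) ^ (1 / 3 : ℝ) / (1 + (η / m) ^ (1 / 3 : ℝ))) :=
        (tendsto_log_corr η).eventually (Ioi_mem_nhds (by linarith))
      refine Filter.le_liminf_of_le (ha_bdd η hη hη23).1.isCoboundedUnder_flip ?_
      filter_upwards [e5, e2, e3, e4, ha_ev η hη hη23, Filter.eventually_ge_atTop M] with m hm5 hm2 hm3 hm4 hma hmM
      have hm2' : 2 ≤ m := hM.trans hmM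
      have hsq := boxRate_le_rate hB hm2' hη hη23 hma.1
      have hmono := hP4 m hmM (η - δ / 2) _ hη'0.le hm2.le hm3.le
      linarith
    exact h1.trans (h2.trans h3)
  -- continuity of f at η
  have hcont : ContinuousAt hsExcessFreeEnergy η :=
    (Clausius.continuousOn_hsExcessFreeEnergy stub_hsFreeEnergyConvex).continuousAt (Ioo_mem_nhds hη hη1)
  have hliminf : hsExcessFreeEnergy η ≤ liminf (fun N : ℕ => -(N : ℝ)⁻¹ * Real.log (hsFreeVolume η N)) atTop := by
    have ht : Tendsto (fun δ : ℝ => hsExcessFreeEnergy (η - δ)) (𝓝[>] 0) (𝓝 (hsExcessFreeEnergy η)) := by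
      have h0 : Tendsto (fun δ : ℝ => η - δ) (𝓝 0) (𝓝 η) := by
        simpa using (tendsto_const_nhds (x := η)).sub (Filter.tendsto_id (x := 𝓝 (0 : ℝ)))
      exact (hcont.tendsto.comp h0).mono_left nhdsWithin_le_nhds
    refine le_of_tendsto ht ?_
    filter_upwards [Ioo_mem_nhdsGT hη] with δ hδ using hkey δ hδ.1 hδ.2
  have hlimsup : limsup (fun N : ℕ => -(N : ℝ)⁻¹ * Real.log (hsFreeVolume η N)) atTop ≤ hsExcessFreeEnergy η :=
    le_rfl
  exact tendsto_of_le_liminf_of_limsup_le hliminf hlimsup (ha_bdd η hη hη23).1 (ha_bdd η hη hη23).2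

/-! ### The box rate: pointwise and uniform lower bounds by `f_ex` -/

/-- **Uniform lower bound for the box rate** (the input of the block large deviations): on every compact
`[a, c] ⊂ (0, 11/10)` and for every `ε > 0`, eventually in `m`, `f_ex(η) − ε ≤ b(m, η)` for ALL
`η ∈ [a, c]`, i.e. `B(m, η) ≤ exp(−m (f_ex(η) − ε))`. [cite: Ruelle1969, §3.4] -/
theorem boxRate_uniform {a c : ℝ} (ha : 0 < a) (hac : a ≤ c) (hc : c < 11 / 10) {ε : ℝ} (hε : 0 < ε) :
    ∀ᶠ m : ℕ in atTop, ∀ η : ℝ, a ≤ η → η ≤ c →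
      hsExcessFreeEnergy η - ε ≤ -(m : ℝ)⁻¹ * Real.log ((volume {w : Fin m → V3 |
        (∀ i l, |w i l| ≤ (1 - (η / m) ^ (1 / 3 : ℝ)) / 2) ∧
          ∀ i j, i ≠ j → (η / m) ^ (1 / 3 : ℝ) ≤ ‖w i - w j‖}).toReal) := by
  set B : ℕ → ℝ → ℝ := fun m η => (volume {w : Fin m → V3 |
    (∀ i l, |w i l| ≤ (1 - (η / m) ^ (1 / 3 : ℝ)) / 2) ∧
      ∀ i j, i ≠ j → (η / m) ^ (1 / 3 : ℝ) ≤ ‖w i - w j‖}).toReal with hBdef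
  have hB : ∀ (m : ℕ) (η : ℝ), B m η = (volume {w : Fin m → V3 |
      (∀ i l, |w i l| ≤ (1 - (η / m) ^ (1 / 3 : ℝ)) / 2) ∧
        ∀ i j, i ≠ j → (η / m) ^ (1 / 3 : ℝ) ≤ ‖w i - w j‖}).toReal := fun _ _ => rfl
  obtain ⟨C, hC, M, hM, hP0, hP4⟩ := ThermoLimitA.rate_props hB
  have hb_ev : ∀ η' : ℝ, 0 ≤ η' → η' ≤ 23 / 20 → ∀ᶠ m : ℕ in atTop,
      0 < B m η' ∧ 0 ≤ -(m : ℝ)⁻¹ * Real.log (B m η') ∧ -(m : ℝ)⁻¹ * Real.log (B m η') ≤ C :=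
    fun η' h0 h1 => Filter.eventually_atTop.2 ⟨M, fun m hm => hP0 m hm η' h0 h1⟩
  have hb_bdd : ∀ η' : ℝ, 0 ≤ η' → η' ≤ 23 / 20 →
      IsBoundedUnder (· ≤ ·) atTop (fun m : ℕ => -(m : ℝ)⁻¹ * Real.log (B m η')) ∧
      IsBoundedUnder (· ≥ ·) atTop (fun m : ℕ => -(m : ℝ)⁻¹ * Real.log (B m η')) :=
    fun η' h0 h1 => ⟨Filter.isBoundedUnder_of_eventually_le ((hb_ev η' h0 h1).mono fun m hm => hm.2.2),
      Filter.isBoundedUnder_of_eventually_ge ((hb_ev η' h0 h1).mono fun m hm => hm.2.1)⟩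
  have ha_ev : ∀ η' : ℝ, 0 < η' → η' ≤ 23 / 20 → ∀ᶠ m : ℕ in atTop,
      -(m : ℝ)⁻¹ * Real.log (hsFreeVolume η' m) ≤ -(m : ℝ)⁻¹ * Real.log (B m η') := by
    intro η' h0 h1
    filter_upwards [Filter.eventually_ge_atTop M] with m hm
    exact rate_le_boxRate hB (hM.trans hm) h0 h1 (hP0 m hm η' h0.le h1).1
  -- pointwise: f η ≤ liminf b(·, η) for η ∈ (0, 11/10)
  have hpt : ∀ η : ℝ, 0 < η → η < 11 / 10 →
      hsExcessFreeEnergy η ≤ liminf (fun m : ℕ => -(m : ℝ)⁻¹ * Real.log (B m η)) atTop := by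
    intro η hη hη1
    have hη23 : η ≤ 23 / 20 := by linarith
    have hkey : ∀ δ : ℝ, 0 < δ → δ < η →
        hsExcessFreeEnergy (η - δ) ≤ liminf (fun m : ℕ => -(m : ℝ)⁻¹ * Real.log (B m η)) atTop := by
      intro δ hδ hδη
      have hηδ0 : 0 < η - δ := by linarith
      have hηδ1 : η - δ ≤ 23 / 20 := by linarith
      have h1 : hsExcessFreeEnergy (η - δ) ≤ limsup (fun m : ℕ => -(m : ℝ)⁻¹ * Real.log (B m (η - δ))) atTop := by
        unfold hsExcessFreeEnergy
        exact Filter.limsup_le_limsup (ha_ev _ hηδ0 hηδ1)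
          (Filter.isBoundedUnder_of ⟨0, fun m => HsFreeEnergyConvex.rate_nonneg (η - δ) m⟩).isCoboundedUnder_flip
          (hb_bdd _ hηδ0.le hηδ1).1
      exact h1.trans (thermo_box_chain η (η - δ) hηδ0.le (by linarith) hη23)
    have hcont : ContinuousAt hsExcessFreeEnergy η :=
      (Clausius.continuousOn_hsExcessFreeEnergy stub_hsFreeEnergyConvex).continuousAt (Ioo_mem_nhds hη hη1)
    have ht : Tendsto (fun δ : ℝ => hsExcessFreeEnergy (η - δ)) (𝓝[>] 0) (𝓝 (hsExcessFreeEnergy η)) := by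
      have h0 : Tendsto (fun δ : ℝ => η - δ) (𝓝 0) (𝓝 η) := by
        simpa using (tendsto_const_nhds (x := η)).sub (Filter.tendsto_id (x := 𝓝 (0 : ℝ)))
      exact (hcont.tendsto.comp h0).mono_left nhdsWithin_le_nhds
    refine le_of_tendsto ht ?_
    filter_upwards [Ioo_mem_nhdsGT hη] with δ hδ using hkey δ hδ.1 hδ.2
  -- uniformity via tl_dini
  have hc23 : c ≤ 23 / 20 := by linarith
  have hF : ContinuousOn hsExcessFreeEnergy (Icc a c) :=
    (Clausius.continuousOn_hsExcessFreeEnergy stub_hsFreeEnergyConvex).mono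
      (fun x hx => ⟨ha.trans_le hx.1, hx.2.trans_lt hc⟩)
  have hmono : ∀ᶠ m : ℕ in atTop, ∀ x y : ℝ, a ≤ x → x ≤ y → y ≤ c →
      -(m : ℝ)⁻¹ * Real.log (B m x) ≤ -(m : ℝ)⁻¹ * Real.log (B m y) := by
    filter_upwards [Filter.eventually_ge_atTop M] with m hm x y hx hxy hy
    exact hP4 m hm x y (ha.le.trans hx) hxy (hy.trans hc23)
  have hpw : ∀ x : ℝ, a ≤ x → x ≤ c → ∀ ε' : ℝ, 0 < ε' →
      ∀ᶠ m : ℕ in atTop, hsExcessFreeEnergy x - ε' ≤ -(m : ℝ)⁻¹ * Real.log (B m x) := by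
    intro x hx hxc ε' hε'
    have hx0 : 0 < x := ha.trans_le hx
    have hlim := hpt x hx0 (hxc.trans_lt hc)
    have hlt : hsExcessFreeEnergy x - ε' < liminf (fun m : ℕ => -(m : ℝ)⁻¹ * Real.log (B m x)) atTop := by
      linarith
    exact (Filter.eventually_lt_of_lt_liminf hlt (hb_bdd x hx0.le (hxc.trans hc23)).2).mono
      fun m hm => hm.le
  exact tl_dini (fun m x => -(m : ℝ)⁻¹ * Real.log (B m x)) hsExcessFreeEnergy a c hac hF hmono hpw ε hε

end ThermoLimit

/-- **Registered helper `hs_thermoLimit` (thermodynamic-limit step of `stub_blockMGF`): the torus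
thermodynamic limit of the hard-sphere free volume EXISTS below packing `11/10` and equals the tree's
`limsup` object:** `∀ η ∈ (0, 11/10), −N⁻¹ log hsFreeVolume η N → hsExcessFreeEnergy η`. [cite: Ruelle1969, Thm 3.4.4] -/
theorem hs_thermoLimit : ∀ (η : ℝ), 0 < η → η < 11 / 10 → Tendsto (fun N : ℕ => -(N : ℝ)⁻¹ * Real.log (hsFreeVolume η N)) atTop (𝓝 (hsExcessFreeEnergy η)) :=
  fun _ hη hη1 => ThermoLimit.tendsto_rate hη hη1

/-- **Registered helper `hs_boxRate_uniform` (thermodynamic-limit step of `stub_blockMGF`, the input of the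
block large deviations): on every compact `[a, c] ⊂ (0, 11/10)` and for every `ε > 0`, eventually in `m`,
Ruelle's inner-cube box free volume satisfies `B(m, η) ≤ exp(−m (f_ex(η) − ε))` for all `η ∈ [a, c]`
(stated on the rate: `f_ex(η) − ε ≤ −m⁻¹ log B(m, η)`).** [cite: Ruelle1969, §3.4] -/
theorem hs_boxRate_uniform : ∀ (a c ε : ℝ), 0 < a → a ≤ c → c < 11 / 10 → 0 < ε → ∀ᶠ m : ℕ in atTop, ∀ η : ℝ, a ≤ η → η ≤ c → hsExcessFreeEnergy η - ε ≤ -(m : ℝ)⁻¹ * Real.log ((volume {w : Fin m → V3 | (∀ i l, |w i l| ≤ (1 - (η / m) ^ (1 / 3 : ℝ)) / 2) ∧ ∀ i j, i ≠ j → (η / m) ^ (1 / 3 : ℝ) ≤ ‖w i - w j‖}).toReal) :=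
  fun _ _ _ ha hac hc hε => ThermoLimit.boxRate_uniform ha hac hc hε

end Barycentric

end Summit.AtomisticToContinuum.HydrodynamicLimit.Theorems.MacroClosureLine

end
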